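/-
Copyright (c) 2026. All rights reserved.
Released under Apache 2.0 license as described in the file LICENSE.
-/
import Mathlib
import Literature.Combinatorics.Hinz2018.RandomMoves

/-!
# Hinz–Klavžar–Petr, *The Tower of Hanoi – Myths and Maths* (2018), 2.3: Hanoi Graphs

[cite: HinzKlavzarPetr2018, Ch. 2 §2.3 (pp. 120–123); Exercises 2.16–2.18, 2.19 c), Ch. 9]

Andreas M. Hinz, Sandi Klavžar, Ciril Petr, *The Tower of Hanoi – Myths and Maths*, second
edition, Birkhäuser/Springer, Cham, 2018 (ISBN 978-3-319-73778-2), Chapter 2 «The Classical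
Tower of Hanoi», Section 2.3 «Hanoi Graphs», read whole in the held text
`book:hinz2018-tower-hanoi-myths-maths` from the heading of 2.3 (end of chunk p0119) over chunk
p0120 to chunk p0121, up to the heading of 2.3.1 «The Linear Tower of Hanoi», together with
Exercises 2.16–2.19 (chunk p0154) and their solutions in Chapter 9 (chunk p0332). The book's
index (chunks p0395–p0408: «Hanoi graph, 61, 63, 120», «matchstick, 122»,
«connectivity, 123», «$H_3^n$ – Hanoi graphs on 3 pegs, 120») places the part read on printed
pp. 120–123; the cite tags below locate every result by its NUMBER in the book ((2.11),
Proposition 2.24, (2.12), Proposition 2.25, Exercises 2.16–2.19), which is unambiguous. This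
module continues the sibling `Hinz2018/RandomMoves` (2.2.2) and IMPORTS it: states of `T^n` as
words `Fin n → ZMod 3` (disc `d + 1` at index `d`), legal moves `WordMove` with the finite move
set `moveFinset` (`mem_moveFinset`, `update_zero_mem_moveFinset`, `mem_moveFinset_one`), the
perfect words `perfectWord`, `perfectWords`, and the optimal path `p1WordPath`
(`p1WordPath_zero`, `p1WordPath_last`, `p1WordPath_move`) are used BY NAME; so are `thirdPeg`
(`3 - i - j`), `thirdPeg_spec`, `thirdPeg_comm`, `thirdPeg_thirdPeg` of `Hinz2018/PerfectToPerfect`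
(§2.1).

## The text and what is typed (complete proofs)

* **The Hanoi graph `H_3^n`** (two states of `T^n` «are adjacent if they are obtained from each
  other by a legal move of one disc»): `hanoiGraph n : SimpleGraph (Fin n → ZMod 3)` with the
  adjacency `HanoiAdj` (= `WordMove` of the sibling:
  `hanoiAdj_iff_wordMove`; neighbours = `moveFinset`: `neighborFinset_eq_moveFinset`,
  `degree_eq_card_moveFinset`); `V(H_3^n) = T^n` has `3^n` elements (Mathlib's `Fintype.card_fun`,
  `ZMod.card`); **(2.11)**, the edges `{s̲ i (3-i-j)^{d-1}, s̲ j (3-i-j)^{d-1}}`: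
  `adj_iff_eq_2_11`; `H_3^0` is a single vertex and `H_3^1 ≅ K_3` (`hanoiGraph_zero_eq_bot`,
  `hanoiGraph_one_eq_top`).
* **(2.12)**, the recursive structure: `E(H_3^0) = ∅` (`hanoiGraph_zero_eq_bot`), the three
  subgraphs `iH_3^n` are copies of `H_3^n` (`adj_snoc_snoc_iff`, the largest disc appended by
  `Fin.snoc`, `eq_snoc`) and `iH_3^n`, `jH_3^n` are «joined by precisely one edge», the edge
  between `ik^n` and `jk^n`, `k = 3 - i - j` (`adj_snoc_snoc_iff_of_ne`, `adj_bridge`);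
  connectedness (`reachable_perfectWord`, `hanoiGraph_connected`).
* **Exercise 2.16** (degrees): the moves at a vertex are the two moves of disc 1
  (`neighborFinset_filter_ne`, `card_neighborFinset_filter_ne`) and at most one move of another
  disc, present iff the state is not perfect (`adj_of_fix_zero`, `fix_zero_move_unique`,
  `exists_adj_fix_zero`, `card_neighborFinset_filter_eq_of_mem`,
  `card_neighborFinset_filter_eq_of_not_mem`); «the perfect states are of degree 2 and all the
  other vertices are of degree 3» (`degree_of_mem_perfectWords`, `degree_perfectWord`,
  `degree_of_not_mem_perfectWords`, `exercise_2_16`, `degree_le_three`; `mem_perfectWords_iff`).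
* **Proposition 2.24** (`χ(H_3^n) = 3 = χ'(H_3^n)`, `n ≥ 1`): the vertex colouring
  `s ↦ (Σ_d s_d) mod 3` (`titSum`, `titSum_ne_of_adj` — «every edge represents the change of
  precisely one tit», `titColoring`, `colorable_three`), the triangles `s̲0, s̲1, s̲2`
  (`three_le_chromaticNumber`) and `χ(H_3^n) = 3` (`chromaticNumber_eq`; `χ(H_3^0) = 1`:
  `chromaticNumber_zero`); the edge colouring by «the label of the idle peg of the move»
  (`edgeIdle`, `edgeIdle_eq_thirdPeg`, `edgeIdle_update_zero`, `edgeIdle_of_fix_zero` — the idle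
  peg of a move of a larger disc is «the position of disc 1», `edgeIdle_ne_of_adj_of_adj`,
  `idleLabel`, `idleColoring`) and `χ'(H_3^n) = 3` typed as the chromatic number of the LINE GRAPH
  (`lineGraph_colorable_three`, `three_le_lineGraph_chromaticNumber`,
  `lineGraph_chromaticNumber_eq`).
* **Exercise 2.17** (a total colouring with at most 4 colours, following Chapter 9: vertex
  colours `0, 1, 2` as in Proposition 2.24, the triangles of disc 1 totally coloured «respecting
  the vertex colors already assigned», «the remaining edges, representing moves of discs 2 to n»
  coloured `3`): `totalVertexColour`, `totalEdgeColour` (colours `Option (ZMod 3)`, `none` =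
  colour `3`; `card_totalColours`) with the three properness conditions
  `totalVertexColour_ne_of_adj`, `totalVertexColour_ne_totalEdgeColour`,
  `totalEdgeColour_ne_of_adj_of_adj`.
* **Exercise 2.18** (`‖H_3^n‖ = (3/2)(3^n - 1)`; the layer of the held copy drops the minus sign
  in the exercise, Chapter 9 and the value fix it): by «the Handshaking Lemma with Exercise 2.16»
  (`perfectWord_injective`, `card_filter_perfectWords`, `sum_degrees`, `two_mul_card_edgeFinset`,
  `exercise_2_18`) and the recurrence `‖H_3^0‖ = 0`, `‖H_3^{1+n}‖ = 3(‖H_3^n‖ + 1)`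
  «stemming from (2.12)» (`card_edgeFinset_recurrence`, here derived from the closed form).
* **Exercise 2.19 c)**: «there are $3^n-3>2$ vertices of odd degree 3» (`card_filter_odd_degree`,
  `n ≥ 1`), so for `n ≥ 2` the graphs «are not even semi-eulerian»: no walk of `H_3^n` is an
  Euler trail, open or closed (`not_isEulerian`, via Mathlib's `SimpleGraph.Walk.IsEulerian`).
* **Proposition 2.25** (`κ(H_3^n) = 2`): the neighbourhood of a perfect state
  (`neighborFinset_of_mem_perfectWords`, `not_adj_perfectWord_perfectWord`); «Deleting the two
  neighbors of a perfect state will separate the latter from the rest of the graph»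
  (`proposition_2_25_cut`, `n ≥ 2`); «the deletion of only one vertex is not sufficient», by the
  book's induction over (2.12) with the bridges `{ik^n, jk^n}` (`HanoiAvoidReach`,
  `hanoiAvoidReach_snoc_of_ne`, `hanoiAvoidReach_snoc_of_avoidReach`, `hanoiAvoidReach_of_ne`,
  `proposition_2_25_no_cut_vertex`, `n ≥ 1`), and the summary `proposition_2_25` (`n ≥ 2`).

## Modelling decisions (OUR READING, said so)

* As in the sibling, a state `s = s_n … s_1 ∈ T^n` is the word `f : Fin n → ZMod 3` with
  `f ⟨d - 1, _⟩ = s_d`; the book's prefix `s̲` of LARGER discs is the tail of our word, and the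
  largest disc `n + 1` of `H_3^{1+n}` is appended with `Fin.snoc`. Pegs are `ZMod 3` and
  `3 - i - j` is `thirdPeg i j = -i - j`.
* `HanoiAdj` and `hanoiGraph` are `abbrev`s of a manifestly decidable formula (one disc changes
  its peg, all smaller discs avoid both pegs), so that Mathlib's `DecidableRel G.Adj`-dependent
  notions (`degree`, `neighborFinset`, `edgeFinset`) elaborate for `H_3^n` without declaring
  instances; the formula is proved equivalent to the sibling's `WordMove` and to (2.11).
* Mathlib has neither the chromatic index nor total colourings nor the vertex-connectivity
  number nor planarity: `χ'` is typed as the chromatic number of `SimpleGraph.lineGraph` (the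
  convention of the tree's `Literature/Combinatorics/Optimization/KonigLineColouring`), the
  total colouring of Exercise 2.17 as two explicit maps with the three properness conditions,
  and `κ(H_3^n) = 2` as the pair of statements "no vertex disconnects" (on the induced
  subgraph of `{v}ᶜ`) and "the two neighbours of `0^n` disconnect" (for `n ≥ 2`; for `n = 1`,
  `H_3^1 ≅ K_3` has `κ = 2` only by the convention `κ(K_m) = m - 1`, which is not typed).
* Exercise 2.19 c)'s «(semi-)eulerian» is read with Mathlib's `Walk.IsEulerian` (a trail, open
  or closed, through every edge exactly once): «not even semi-eulerian» = no such walk. That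
  `H_3^0` and `H_3^1 ≅ K_3` are eulerian is not typed.
* Propositions 2.24 and 2.25 are stated for `n ∈ ℕ = {1, 2, …}`; our versions carry `1 ≤ n`
  (or `2 ≤ n`) where needed and record the degenerate `H_3^0` separately.

## NOT TYPED (said so)

The introductory remarks (the binary tree of shortest paths to `0^n` with root `0^n` and height
`2^n - 1`, Er [129]; «The trees mentioned above are obtained from these graphs by deleting all
horizontal edges»); the attributions Scorer et al. [378], [277, p. 24], Hinze [215], [396,
Figure 4]; Figures 2.10–2.13 as pictures and the labelling procedure of the standard drawings
(reflections and rotations by `120°`); planarity and the matchstick property ([378, p. 97], [98,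
Chapitre 12] — Mathlib has no planar graphs); Exercise 2.18's third approach «to use (2.11)
directly»; Exercise 2.19 a), b) (the unique hamiltonian `i^n, j^n`-path and hamiltonicity), which
belong with 2.3.1 «The Linear Tower of Hanoi» (that path IS the Linear Tower of Hanoi) and are
left to that later anchor; and everything from 2.3.1 on.
-/

namespace Literature.Combinatorics.Hinz2018

open Finset

/-! ## The Hanoi graphs `H_3^n` -/

/-- A legal move between two words of `T^n` (disc `d + 1` at index `d`, index `0` the smallest
disc), in decidable form: exactly one disc `d` changes its peg, and every smaller disc lies
neither on the source nor on the target peg of `d`.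
[cite: HinzKlavzarPetr2018, Ch. 2 §2.3 p. 120 (the Hanoi graph H_3^n)] -/
abbrev HanoiAdj (n : ℕ) (f g : Fin n → ZMod 3) : Prop :=
  ∃ d : Fin n, f d ≠ g d ∧ (∀ e, e ≠ d → g e = f e) ∧ ∀ e, e < d → f e ≠ f d ∧ f e ≠ g d

/-- Legal moves are reversible.
[cite: HinzKlavzarPetr2018, Ch. 2 §2.3 p. 120 (the Hanoi graph H_3^n)] -/
theorem HanoiAdj.symm {n : ℕ} {f g : Fin n → ZMod 3} (h : HanoiAdj n f g) : HanoiAdj n g f := by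
  obtain ⟨d, hne, hoff, hsm⟩ := h
  refine ⟨d, hne.symm, fun e he => (hoff e he).symm, fun e he => ?_⟩
  rw [hoff e (ne_of_lt he)]
  exact ⟨(hsm e he).2, (hsm e he).1⟩

/-- No move leads from a state to itself.
[cite: HinzKlavzarPetr2018, Ch. 2 §2.3 p. 120 (the Hanoi graph H_3^n)] -/
theorem HanoiAdj.irrefl {n : ℕ} (f : Fin n → ZMod 3) : ¬ HanoiAdj n f f :=
  fun ⟨_, h, _⟩ => h rfl

/-- The **Hanoi graph** `H_3^n`: vertex set `T^n` (words `Fin n → ZMod 3`), two regular states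
being adjacent if they are obtained from each other by a legal move of one disc.
[cite: HinzKlavzarPetr2018, Ch. 2 §2.3 p. 120 (the Hanoi graph H_3^n)] -/
abbrev hanoiGraph (n : ℕ) : SimpleGraph (Fin n → ZMod 3) where
  Adj f g := HanoiAdj n f g
  symm := ⟨fun _ _ h => h.symm⟩
  loopless := ⟨fun f h => HanoiAdj.irrefl f h⟩

/-- Adjacency in `H_3^n` is a legal move.
[cite: HinzKlavzarPetr2018, Ch. 2 §2.3 p. 120 (the Hanoi graph H_3^n)] -/
theorem hanoiGraph_adj {n : ℕ} {f g : Fin n → ZMod 3} :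
    (hanoiGraph n).Adj f g ↔ HanoiAdj n f g := Iff.rfl

/-- The decidable adjacency is the legal move of §2.1 (`HanoiMove`) between the states of the
two words (`WordMove` of the sibling).
[cite: HinzKlavzarPetr2018, Ch. 2 §2.3 p. 120 (the Hanoi graph H_3^n)] -/
theorem hanoiAdj_iff_wordMove {n : ℕ} {f g : Fin n → ZMod 3} :
    HanoiAdj n f g ↔ WordMove n f g := by
  constructor
  · rintro ⟨d, hne, hoff, hsm⟩
    refine ⟨d.val + 1, by omega, by omega, ?_, ?_, ?_⟩
    · rw [stateOf_disc, stateOf_disc]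
      exact hne
    · intro e he
      by_cases hr : 1 ≤ e ∧ e ≤ n
      · have : e = (⟨e - 1, by omega⟩ : Fin n).val + 1 := by simp; omega
        rw [this, stateOf_disc, stateOf_disc]
        exact hoff _ (fun H => he (by rw [Fin.ext_iff] at H; simp at H; omega))
      · rw [stateOf_outside _ (by omega), stateOf_outside _ (by omega)]
    · intro e he1 hed
      have : e = (⟨e - 1, by omega⟩ : Fin n).val + 1 := by simp; omega
      rw [this, stateOf_disc, stateOf_disc, stateOf_disc]
      exact hsm _ (by rw [Fin.lt_def]; simp; omega)
  · rintro ⟨D, hD1, hDn, hne, hoff, hsm⟩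
    have hD : D = (⟨D - 1, by omega⟩ : Fin n).val + 1 := by simp; omega
    refine ⟨⟨D - 1, by omega⟩, ?_, ?_, ?_⟩
    · rw [hD, stateOf_disc, stateOf_disc] at hne
      exact hne
    · intro e he
      have h := hoff (e.val + 1) (fun H => he (Fin.ext (by simp; omega)))
      rwa [stateOf_disc, stateOf_disc] at h
    · intro e he
      rw [Fin.lt_def] at he
      simp only at he
      have h := hsm (e.val + 1) (by omega) (by omega)
      rw [hD, stateOf_disc, stateOf_disc, stateOf_disc] at h
      exact h

/-- The neighbourhood of the sibling (`moveFinset`) is the neighbourhood in `H_3^n`.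
[cite: HinzKlavzarPetr2018, Ch. 2 §2.3 p. 120 (the Hanoi graph H_3^n)] -/
theorem mem_moveFinset_iff_adj {n : ℕ} {f g : Fin n → ZMod 3} :
    g ∈ moveFinset n f ↔ (hanoiGraph n).Adj f g := by
  rw [mem_moveFinset, hanoiGraph_adj, hanoiAdj_iff_wordMove]

/-- The neighbourhood of the sibling (`moveFinset`) is the neighbourhood in `H_3^n`.
[cite: HinzKlavzarPetr2018, Ch. 2 §2.3 p. 120 (the Hanoi graph H_3^n)] -/
theorem neighborFinset_eq_moveFinset {n : ℕ} (f : Fin n → ZMod 3) :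
    (hanoiGraph n).neighborFinset f = moveFinset n f := by
  ext g
  rw [SimpleGraph.mem_neighborFinset, mem_moveFinset_iff_adj]

/-- The degree of a vertex of `H_3^n` is the number of legal moves from it.
[cite: HinzKlavzarPetr2018, Ch. 2 §2.3 p. 120 (the Hanoi graph H_3^n)] -/
theorem degree_eq_card_moveFinset {n : ℕ} (f : Fin n → ZMod 3) :
    (hanoiGraph n).degree f = (moveFinset n f).card := by
  rw [← SimpleGraph.card_neighborFinset_eq_degree, neighborFinset_eq_moveFinset]

/-- **(2.11)**: each edge of `H_3^n` is `{s̲ i k^{d-1}, s̲ j k^{d-1}}` with `i ≠ j`,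
`k = 3 - i - j`: a move of disc `d` between pegs `i` and `j`, the smaller discs on peg `k`, the
larger discs (`s̲`) arbitrary and unchanged.
[cite: HinzKlavzarPetr2018, Ch. 2 §2.3 p. 120, (2.11)] -/
theorem adj_iff_eq_2_11 {n : ℕ} {f g : Fin n → ZMod 3} : (hanoiGraph n).Adj f g ↔
    ∃ d : Fin n, f d ≠ g d ∧ (∀ e, d < e → g e = f e) ∧
      ∀ e, e < d → f e = thirdPeg (f d) (g d) ∧ g e = thirdPeg (f d) (g d) := by
  constructor
  · rintro ⟨d, hne, hoff, hsm⟩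
    refine ⟨d, hne, fun e he => hoff e (ne_of_gt he), fun e he => ?_⟩
    have h3 := (thirdPeg_spec (f d) (g d) hne).2.2 (f e) (hsm e he).1 (hsm e he).2
    refine ⟨h3, ?_⟩
    rw [hoff e (ne_of_lt he)]
    exact h3
  · rintro ⟨d, hne, hoff, hsm⟩
    refine ⟨d, hne, fun e he => ?_, fun e he => ?_⟩
    · rcases lt_or_gt_of_ne he with h | h
      · rw [(hsm e h).1, (hsm e h).2]
      · exact hoff e h
    · rw [(hsm e he).1]
      exact ⟨(thirdPeg_spec _ _ hne).1, (thirdPeg_spec _ _ hne).2.1⟩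

/-- `H_3^0` has no edges (`E(H_3^0) = ∅`).
[cite: HinzKlavzarPetr2018, Ch. 2 §2.3 (2.12) (E(H_3^0) = ∅), Fig. 2.11] -/
theorem hanoiGraph_zero_not_adj (f g : Fin 0 → ZMod 3) : ¬ (hanoiGraph 0).Adj f g :=
  fun ⟨d, _⟩ => d.elim0

/-- `H_3^0 = K_1` has the empty edge relation.
[cite: HinzKlavzarPetr2018, Ch. 2 §2.3 (2.12) (E(H_3^0) = ∅), Fig. 2.11] -/
theorem hanoiGraph_zero_eq_bot : hanoiGraph 0 = ⊥ := by
  ext f g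
  exact ⟨fun h => hanoiGraph_zero_not_adj f g h, fun h => h.elim⟩

/-- In `H_3^1` any two distinct states are adjacent.
[cite: HinzKlavzarPetr2018, Ch. 2 §2.3 Fig. 2.11; Prop. 2.25 (proof: H_3^1 ≅ K_3)] -/
theorem hanoiGraph_one_adj_iff {f g : Fin 1 → ZMod 3} : (hanoiGraph 1).Adj f g ↔ f ≠ g := by
  rw [← mem_moveFinset_iff_adj, mem_moveFinset_one]
  exact ne_comm

/-- `H_3^1 ≅ K_3`: the Hanoi graph for one disc is the complete graph on `T`.
[cite: HinzKlavzarPetr2018, Ch. 2 §2.3 Fig. 2.11; Prop. 2.25 (proof: H_3^1 ≅ K_3)] -/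
theorem hanoiGraph_one_eq_top : hanoiGraph 1 = ⊤ := by
  ext f g
  rw [hanoiGraph_one_adj_iff, SimpleGraph.top_adj]

/-! ## The recursive structure (2.12) -/

/-- Every word of `T^{1+n}` is `s̲ i`: the largest disc `n + 1` (last index) on some peg `i` on
top of the word `s̲ ∈ T^n` of the other discs (`Fin.snoc`).
[cite: HinzKlavzarPetr2018, Ch. 2 §2.3 p. 121, (2.12)] -/
theorem eq_snoc {n : ℕ} (f : Fin (n + 1) → ZMod 3) :
    f = Fin.snoc (Fin.init f) (f (Fin.last n)) :=
  (Fin.snoc_init_self f).symm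

/-- **(2.12)**, first part: inside the subgraph `iH_3^n` (largest disc on peg `i`) the edges are
exactly those of `H_3^n`: `{ir, is} ∈ E(H_3^{1+n}) ⇔ {r, s} ∈ E(H_3^n)`.
[cite: HinzKlavzarPetr2018, Ch. 2 §2.3 p. 121, (2.12)] -/
theorem adj_snoc_snoc_iff {n : ℕ} {r s : Fin n → ZMod 3} {i : ZMod 3} :
    (hanoiGraph (n + 1)).Adj (Fin.snoc r i : Fin (n + 1) → ZMod 3) (Fin.snoc s i) ↔
      (hanoiGraph n).Adj r s := by
  constructor
  · rintro ⟨d, hne, hoff, hsm⟩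
    induction d using Fin.lastCases with
    | last => simp [Fin.snoc_last] at hne
    | cast d =>
      refine ⟨d, by simpa [Fin.snoc_castSucc] using hne, fun e he => ?_, fun e he => ?_⟩
      · have := hoff (Fin.castSucc e) (fun H => he (Fin.castSucc_injective _ H))
        simpa [Fin.snoc_castSucc] using this
      · have := hsm (Fin.castSucc e) (Fin.castSucc_lt_castSucc_iff.mpr he)
        simpa [Fin.snoc_castSucc] using this
  · rintro ⟨d, hne, hoff, hsm⟩
    refine ⟨Fin.castSucc d, by simpa [Fin.snoc_castSucc] using hne, fun e he => ?_,
      fun e he => ?_⟩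
    · induction e using Fin.lastCases with
      | last => simp [Fin.snoc_last]
      | cast e =>
        have : e ≠ d := fun H => he (by rw [H])
        simpa [Fin.snoc_castSucc] using hoff e this
    · induction e using Fin.lastCases with
      | last => exact absurd he (not_lt.mpr (Fin.castSucc_lt_last d).le)
      | cast e => simpa [Fin.snoc_castSucc] using hsm e (Fin.castSucc_lt_castSucc_iff.mp he)

/-- **(2.12)**, second part: two different subgraphs `iH_3^n` and `jH_3^n` are joined by
precisely one edge, the edge between `ik^n` and `jk^n`, `k = 3 - i - j` (the move of the
largest disc). [cite: HinzKlavzarPetr2018, Ch. 2 §2.3 p. 121, (2.12)] -/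
theorem adj_snoc_snoc_iff_of_ne {n : ℕ} {r s : Fin n → ZMod 3} {i j : ZMod 3} (hij : i ≠ j) :
    (hanoiGraph (n + 1)).Adj (Fin.snoc r i : Fin (n + 1) → ZMod 3) (Fin.snoc s j) ↔
      r = perfectWord n (thirdPeg i j) ∧ s = perfectWord n (thirdPeg i j) := by
  constructor
  · rintro ⟨d, hne, hoff, hsm⟩
    induction d using Fin.lastCases with
    | cast d =>
      have := hoff (Fin.last n) (Fin.castSucc_lt_last d).ne'
      simp [Fin.snoc_last] at this
      exact absurd this.symm hij
    | last =>
      have key : ∀ e : Fin n, r e = thirdPeg i j ∧ s e = thirdPeg i j := fun e => by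
        have h1 := hsm (Fin.castSucc e) (Fin.castSucc_lt_last e)
        have h2 := hoff (Fin.castSucc e) (Fin.castSucc_lt_last e).ne
        simp only [Fin.snoc_castSucc, Fin.snoc_last] at h1 h2
        have h3 := (thirdPeg_spec i j hij).2.2 (r e) h1.1 h1.2
        exact ⟨h3, h2.trans h3⟩
      exact ⟨funext fun e => (key e).1, funext fun e => (key e).2⟩
  · rintro ⟨rfl, rfl⟩
    refine ⟨Fin.last n, by simpa [Fin.snoc_last] using hij, fun e he => ?_, fun e he => ?_⟩
    · induction e using Fin.lastCases with
      | last => exact absurd rfl he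
      | cast e => simp [Fin.snoc_castSucc]
    · induction e using Fin.lastCases with
      | last => exact absurd he (lt_irrefl _)
      | cast e =>
        simp only [Fin.snoc_castSucc, Fin.snoc_last, perfectWord]
        exact ⟨(thirdPeg_spec i j hij).1, (thirdPeg_spec i j hij).2.1⟩

/-! ## Connectedness -/

/-- Every state is joined to each perfect state by a walk (the legal path of Theorem 2.7).
[cite: HinzKlavzarPetr2018, Ch. 2 §2.3 p. 121, (2.12) (connectedness)] -/
theorem reachable_perfectWord {n : ℕ} (f : Fin n → ZMod 3) (j : ZMod 3) :
    (hanoiGraph n).Reachable f (perfectWord n j) := by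
  have key : ∀ k, k ≤ p1Dist n (stateOf f) j →
      (hanoiGraph n).Reachable f (p1WordPath n f j k) := by
    intro k hk
    induction k with
    | zero => rw [p1WordPath_zero]
    | succ k ih =>
      exact (ih (by omega)).trans (SimpleGraph.Adj.reachable
        (mem_moveFinset_iff_adj.mp (p1WordPath_move n f j (by omega))))
  have := key _ le_rfl
  rwa [p1WordPath_last] at this

/-- `H_3^n` is connected. [cite: HinzKlavzarPetr2018, Ch. 2 §2.3 p. 121, (2.12) (connectedness)] -/
theorem hanoiGraph_connected (n : ℕ) : (hanoiGraph n).Connected := by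
  rw [SimpleGraph.connected_iff]
  exact ⟨fun f g => (reachable_perfectWord f 0).trans (reachable_perfectWord g 0).symm,
    ⟨fun _ => 0⟩⟩


/-! ## The moves at a vertex (Exercise 2.16: the degrees) -/

/-- Disc 1 may always be moved to any other peg.
[cite: HinzKlavzarPetr2018, Exercise 2.16 and Ch. 9; Ch. 2 §2.3 Prop. 2.24 (proof)] -/
theorem adj_update_zero {n : ℕ} (hn : 1 ≤ n) (f : Fin n → ZMod 3) {a : ZMod 3}
    (ha : a ≠ f ⟨0, hn⟩) : (hanoiGraph n).Adj f (Function.update f ⟨0, hn⟩ a) :=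
  mem_moveFinset_iff_adj.mp (update_zero_mem_moveFinset hn f ha)

/-- The states `s̲0`, `s̲1`, `s̲2` (all discs but disc 1 fixed) are pairwise adjacent: they
«induce a complete graph on 3 vertices».
[cite: HinzKlavzarPetr2018, Exercise 2.16 and Ch. 9; Ch. 2 §2.3 Prop. 2.24 (proof)] -/
theorem adj_update_zero_update_zero {n : ℕ} (hn : 1 ≤ n) (f : Fin n → ZMod 3) {a b : ZMod 3}
    (hab : a ≠ b) :
    (hanoiGraph n).Adj (Function.update f ⟨0, hn⟩ a) (Function.update f ⟨0, hn⟩ b) := by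
  have h := adj_update_zero hn (Function.update f ⟨0, hn⟩ a) (a := b)
    (by rw [Function.update_self]; exact hab.symm)
  rwa [Function.update_idem] at h

/-- A move that changes the peg of disc 1 is a move of disc 1.
[cite: HinzKlavzarPetr2018, Exercise 2.16 and Ch. 9; Ch. 2 §2.3 Prop. 2.24 (proof)] -/
theorem eq_update_zero_of_adj {n : ℕ} (hn : 1 ≤ n) {f g : Fin n → ZMod 3}
    (h : (hanoiGraph n).Adj f g) (hz : g ⟨0, hn⟩ ≠ f ⟨0, hn⟩) :
    g = Function.update f ⟨0, hn⟩ (g ⟨0, hn⟩) := by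
  obtain ⟨d, hne, hoff, hsm⟩ := h
  have hd : d = ⟨0, hn⟩ := by
    by_contra H
    exact hz (hoff _ (fun H' => H H'.symm))
  funext e
  by_cases he : e = ⟨0, hn⟩
  · subst he
    rw [Function.update_self]
  · rw [Function.update_of_ne he, hoff e (fun H => he (H.trans hd))]

/-- A move of a disc other than disc 1 (the book: the idle peg is then «the position of disc 1
in case another disc is moving»): the moved disc `d` is the smallest disc not on the peg of
disc 1, and it goes to the peg carrying neither disc 1 nor disc `d`.
[cite: HinzKlavzarPetr2018, Exercise 2.16 and Ch. 9; Ch. 2 §2.3 Prop. 2.24 (proof)] -/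
theorem adj_of_fix_zero {n : ℕ} (hn : 1 ≤ n) {f g : Fin n → ZMod 3}
    (h : (hanoiGraph n).Adj f g) (hz : g ⟨0, hn⟩ = f ⟨0, hn⟩) :
    ∃ d : Fin n, ⟨0, hn⟩ < d ∧ (∀ e, e < d → f e = f ⟨0, hn⟩) ∧ f d ≠ f ⟨0, hn⟩ ∧
      g = Function.update f d (thirdPeg (f ⟨0, hn⟩) (f d)) := by
  obtain ⟨d, hne, hoff, hsm⟩ := adj_iff_eq_2_11.mp h
  have hdz : (⟨0, hn⟩ : Fin n) ≠ d := fun H => hne (by rw [← H, hz])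
  have hlt : (⟨0, hn⟩ : Fin n) < d := lt_of_le_of_ne (Fin.le_def.mpr (Nat.zero_le _)) hdz
  have hz3 : f ⟨0, hn⟩ = thirdPeg (f d) (g d) := (hsm _ hlt).1
  have hgd : g d = thirdPeg (f ⟨0, hn⟩) (f d) := by
    rw [hz3, thirdPeg_comm (thirdPeg (f d) (g d)) (f d), (thirdPeg_thirdPeg hne).1]
  refine ⟨d, hlt, fun e he => by rw [(hsm e he).1, hz3], ?_, ?_⟩
  · rw [hz3]
    exact (thirdPeg_spec (f d) (g d) hne).1.symm
  · funext e
    by_cases hed : e = d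
    · subst hed
      rw [Function.update_self, hgd]
    · rw [Function.update_of_ne hed]
      rcases lt_or_gt_of_ne hed with hl | hl
      · rw [(hsm e hl).1, (hsm e hl).2]
      · exact hoff e hl

/-- At most one move from a given state moves a disc other than disc 1.
[cite: HinzKlavzarPetr2018, Exercise 2.16 and Ch. 9; Ch. 2 §2.3 Prop. 2.24 (proof)] -/
theorem fix_zero_move_unique {n : ℕ} (hn : 1 ≤ n) {f g g' : Fin n → ZMod 3}
    (h : (hanoiGraph n).Adj f g) (h' : (hanoiGraph n).Adj f g') (hz : g ⟨0, hn⟩ = f ⟨0, hn⟩)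
    (hz' : g' ⟨0, hn⟩ = f ⟨0, hn⟩) : g = g' := by
  obtain ⟨d, -, hmin, hne, hg⟩ := adj_of_fix_zero hn h hz
  obtain ⟨d', -, hmin', hne', hg'⟩ := adj_of_fix_zero hn h' hz'
  have hdd : d = d' := by
    by_contra H
    rcases lt_or_gt_of_ne H with hl | hl
    · exact hne (hmin' d hl)
    · exact hne' (hmin d' hl)
  rw [hg, hg', hdd]

/-- A word is perfect iff all its discs are on the peg of disc 1.
[cite: HinzKlavzarPetr2018, Exercise 2.16 and Ch. 9; Ch. 2 §2.3 Prop. 2.24 (proof)] -/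
theorem mem_perfectWords_iff {n : ℕ} (hn : 1 ≤ n) {f : Fin n → ZMod 3} :
    f ∈ perfectWords n ↔ ∀ e, f e = f ⟨0, hn⟩ := by
  constructor
  · rintro ⟨i, rfl⟩ e
    rfl
  · intro h
    exact ⟨f ⟨0, hn⟩, funext fun e => (h e).symm⟩

/-- From a non-perfect state some disc other than disc 1 can be moved: the smallest disc not
on the peg of disc 1, onto the third peg.
[cite: HinzKlavzarPetr2018, Exercise 2.16 and Ch. 9; Ch. 2 §2.3 Prop. 2.24 (proof)] -/
theorem exists_adj_fix_zero {n : ℕ} (hn : 1 ≤ n) {f : Fin n → ZMod 3}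
    (hf : f ∉ perfectWords n) :
    ∃ g, (hanoiGraph n).Adj f g ∧ g ⟨0, hn⟩ = f ⟨0, hn⟩ := by
  classical
  rw [mem_perfectWords_iff hn] at hf
  obtain ⟨e₀, he₀⟩ := not_forall.mp hf
  set S := Finset.univ.filter (fun e : Fin n => f e ≠ f ⟨0, hn⟩) with hS_def
  have hS : S.Nonempty := ⟨e₀, by simp [hS_def, he₀]⟩
  have hdS : S.min' hS ∈ S := Finset.min'_mem S hS
  have hd : f (S.min' hS) ≠ f ⟨0, hn⟩ := by
    have := hdS
    simp only [hS_def, Finset.mem_filter, Finset.mem_univ, true_and] at this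
    exact this
  have hmin : ∀ e, e < S.min' hS → f e = f ⟨0, hn⟩ := fun e he => by
    by_contra H
    exact absurd (Finset.min'_le S e (by simp [hS_def, H])) (not_le.mpr he)
  set d := S.min' hS with hd_def
  refine ⟨Function.update f d (thirdPeg (f ⟨0, hn⟩) (f d)), ?_, ?_⟩
  · rw [adj_iff_eq_2_11]
    have h3 := thirdPeg_spec (f ⟨0, hn⟩) (f d) hd.symm
    refine ⟨d, ?_, fun e he => ?_, fun e he => ?_⟩
    · rw [Function.update_self]
      exact h3.2.1.symm
    · exact Function.update_of_ne (ne_of_gt he) _ _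
    · rw [Function.update_self, Function.update_of_ne (ne_of_lt he), hmin e he,
        thirdPeg_comm (f ⟨0, hn⟩) (f d), (thirdPeg_thirdPeg hd).1]
      exact ⟨rfl, rfl⟩
  · have hdz : (⟨0, hn⟩ : Fin n) ≠ d := fun H => hd (by rw [← H])
    exact Function.update_of_ne hdz _ _

/-- From a perfect state only disc 1 can be moved.
[cite: HinzKlavzarPetr2018, Exercise 2.16 and Ch. 9; Ch. 2 §2.3 Prop. 2.24 (proof)] -/
theorem ne_of_adj_of_mem_perfectWords {n : ℕ} (hn : 1 ≤ n) {f g : Fin n → ZMod 3}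
    (hf : f ∈ perfectWords n) (h : (hanoiGraph n).Adj f g) : g ⟨0, hn⟩ ≠ f ⟨0, hn⟩ := by
  intro hz
  obtain ⟨d, -, -, hne, -⟩ := adj_of_fix_zero hn h hz
  exact hne ((mem_perfectWords_iff hn).mp hf d)

/-- The two moves of disc 1 from any state.
[cite: HinzKlavzarPetr2018, Exercise 2.16 and Ch. 9; Ch. 2 §2.3 Prop. 2.24 (proof)] -/
theorem neighborFinset_filter_ne {n : ℕ} (hn : 1 ≤ n) (f : Fin n → ZMod 3) :
    ((hanoiGraph n).neighborFinset f).filter (fun g => g ⟨0, hn⟩ ≠ f ⟨0, hn⟩) =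
      (Finset.univ.erase (f ⟨0, hn⟩)).image (fun a => Function.update f ⟨0, hn⟩ a) := by
  ext g
  simp only [Finset.mem_filter, SimpleGraph.mem_neighborFinset, Finset.mem_image,
    Finset.mem_erase, Finset.mem_univ, and_true]
  constructor
  · rintro ⟨h, hz⟩
    exact ⟨g ⟨0, hn⟩, hz, (eq_update_zero_of_adj hn h hz).symm⟩
  · rintro ⟨a, ha, rfl⟩
    refine ⟨adj_update_zero hn f ha, ?_⟩
    rw [Function.update_self]
    exact ha

/-- There are exactly «two for the moves of disc 1» at every vertex.
[cite: HinzKlavzarPetr2018, Exercise 2.16 and Ch. 9; Ch. 2 §2.3 Prop. 2.24 (proof)] -/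
theorem card_neighborFinset_filter_ne {n : ℕ} (hn : 1 ≤ n) (f : Fin n → ZMod 3) :
    (((hanoiGraph n).neighborFinset f).filter (fun g => g ⟨0, hn⟩ ≠ f ⟨0, hn⟩)).card = 2 := by
  rw [neighborFinset_filter_ne hn f, Finset.card_image_of_injective _ (fun a b h => by
    simpa using congr_fun h ⟨0, hn⟩), Finset.card_erase_of_mem (Finset.mem_univ _),
    Finset.card_univ, ZMod.card]

/-- A perfect state admits no move of a disc other than disc 1.
[cite: HinzKlavzarPetr2018, Exercise 2.16 and Ch. 9; Ch. 2 §2.3 Prop. 2.24 (proof)] -/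
theorem card_neighborFinset_filter_eq_of_mem {n : ℕ} (hn : 1 ≤ n) {f : Fin n → ZMod 3}
    (hf : f ∈ perfectWords n) :
    (((hanoiGraph n).neighborFinset f).filter (fun g => g ⟨0, hn⟩ = f ⟨0, hn⟩)).card = 0 := by
  rw [Finset.card_eq_zero, Finset.filter_eq_empty_iff]
  intro g hg
  rw [SimpleGraph.mem_neighborFinset] at hg
  exact ne_of_adj_of_mem_perfectWords hn hf hg

/-- A non-perfect state admits exactly one move of a disc other than disc 1.
[cite: HinzKlavzarPetr2018, Exercise 2.16 and Ch. 9; Ch. 2 §2.3 Prop. 2.24 (proof)] -/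
theorem card_neighborFinset_filter_eq_of_not_mem {n : ℕ} (hn : 1 ≤ n) {f : Fin n → ZMod 3}
    (hf : f ∉ perfectWords n) :
    (((hanoiGraph n).neighborFinset f).filter (fun g => g ⟨0, hn⟩ = f ⟨0, hn⟩)).card = 1 := by
  apply le_antisymm
  · rw [Finset.card_le_one]
    intro a ha b hb
    simp only [Finset.mem_filter, SimpleGraph.mem_neighborFinset] at ha hb
    exact fix_zero_move_unique hn ha.1 hb.1 ha.2 hb.2
  · obtain ⟨g, hg, hgz⟩ := exists_adj_fix_zero hn hf
    exact Finset.card_pos.mpr ⟨g, Finset.mem_filter.mpr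
      ⟨(SimpleGraph.mem_neighborFinset _ _ _).mpr hg, hgz⟩⟩

/-- The degree splits into the moves of disc 1 and the moves of another disc.
[cite: HinzKlavzarPetr2018, Exercise 2.16 and Ch. 9; Ch. 2 §2.3 Prop. 2.24 (proof)] -/
theorem degree_eq_two_add {n : ℕ} (hn : 1 ≤ n) (f : Fin n → ZMod 3) :
    (hanoiGraph n).degree f =
      2 + (((hanoiGraph n).neighborFinset f).filter (fun g => g ⟨0, hn⟩ = f ⟨0, hn⟩)).card := by
  rw [← SimpleGraph.card_neighborFinset_eq_degree,
    ← Finset.card_filter_add_card_filter_not (fun g => g ⟨0, hn⟩ = f ⟨0, hn⟩),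
    add_comm]
  congr 1
  convert card_neighborFinset_filter_ne hn f using 3

/-- **Exercise 2.16**, perfect states: «the perfect states are of degree 2».
[cite: HinzKlavzarPetr2018, Exercise 2.16 and Ch. 9] -/
theorem degree_of_mem_perfectWords {n : ℕ} (hn : 1 ≤ n) {f : Fin n → ZMod 3}
    (hf : f ∈ perfectWords n) : (hanoiGraph n).degree f = 2 := by
  rw [degree_eq_two_add hn, card_neighborFinset_filter_eq_of_mem hn hf]

/-- **Exercise 2.16**, perfect states: `deg(i^n) = 2` for `n ≥ 1`.
[cite: HinzKlavzarPetr2018, Exercise 2.16 and Ch. 9] -/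
theorem degree_perfectWord {n : ℕ} (hn : 1 ≤ n) (i : ZMod 3) :
    (hanoiGraph n).degree (perfectWord n i) = 2 :=
  degree_of_mem_perfectWords hn ⟨i, rfl⟩

/-- **Exercise 2.16**, the other states: «all the other vertices are of degree 3».
[cite: HinzKlavzarPetr2018, Exercise 2.16 and Ch. 9] -/
theorem degree_of_not_mem_perfectWords {n : ℕ} {f : Fin n → ZMod 3} (hf : f ∉ perfectWords n) :
    (hanoiGraph n).degree f = 3 := by
  have hn : 1 ≤ n := by
    rcases Nat.eq_zero_or_pos n with h0 | h0
    · subst h0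
      exact absurd ⟨0, funext fun e => e.elim0⟩ hf
    · exact h0
  rw [degree_eq_two_add hn, card_neighborFinset_filter_eq_of_not_mem hn hf]

/-- **Exercise 2.16** (the degree sequence of `H_3^n`, `n ≥ 1`): degree `2` at the three perfect
states, degree `3` everywhere else. [cite: HinzKlavzarPetr2018, Exercise 2.16 and Ch. 9] -/
theorem exercise_2_16 {n : ℕ} (hn : 1 ≤ n) (f : Fin n → ZMod 3) :
    ((hanoiGraph n).degree f = 2 ∧ f ∈ perfectWords n) ∨
      ((hanoiGraph n).degree f = 3 ∧ f ∉ perfectWords n) := by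
  by_cases hf : f ∈ perfectWords n
  · exact Or.inl ⟨degree_of_mem_perfectWords hn hf, hf⟩
  · exact Or.inr ⟨degree_of_not_mem_perfectWords hf, hf⟩

/-- `H_3^0` consists of one vertex of degree `0`.
[cite: HinzKlavzarPetr2018, Exercise 2.16 and Ch. 9] -/
theorem degree_hanoiGraph_zero (f : Fin 0 → ZMod 3) : (hanoiGraph 0).degree f = 0 := by
  rw [← SimpleGraph.card_neighborFinset_eq_degree, Finset.card_eq_zero,
    Finset.eq_empty_iff_forall_notMem]
  intro g hg
  rw [SimpleGraph.mem_neighborFinset] at hg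
  exact hanoiGraph_zero_not_adj f g hg

/-- The maximal degree of a Hanoi graph is at most `3`.
[cite: HinzKlavzarPetr2018, Exercise 2.16 and Ch. 9] -/
theorem degree_le_three {n : ℕ} (f : Fin n → ZMod 3) : (hanoiGraph n).degree f ≤ 3 := by
  rcases Nat.eq_zero_or_pos n with h0 | hn
  · subst h0
    rw [degree_hanoiGraph_zero]
    omega
  · rcases exercise_2_16 hn f with ⟨h, -⟩ | ⟨h, -⟩ <;> omega


/-! ## Proposition 2.24: colourings of Hanoi graphs -/

/-- The vertex colour of Proposition 2.24: `s ↦ (Σ_{d=1}^{n} s_d) mod 3`.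
[cite: HinzKlavzarPetr2018, Ch. 2 §2.3 Prop. 2.24, p. 120] -/
def titSum {n : ℕ} (f : Fin n → ZMod 3) : ZMod 3 := ∑ d, f d

/-- «every edge represents the change of precisely one tit in the adjacent vertices», so the
tit sums of adjacent vertices differ. [cite: HinzKlavzarPetr2018, Ch. 2 §2.3 Prop. 2.24, p. 120] -/
theorem titSum_ne_of_adj {n : ℕ} {f g : Fin n → ZMod 3} (h : (hanoiGraph n).Adj f g) :
    titSum f ≠ titSum g := by
  obtain ⟨d, hne, hoff, -⟩ := h
  intro H
  have hs : ∑ e, (g e - f e) = g d - f d :=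
    Finset.sum_eq_single d (fun e _ he => by rw [hoff e he, sub_self]) (by simp)
  rw [Finset.sum_sub_distrib] at hs
  unfold titSum at H
  rw [H, sub_self] at hs
  exact hne (sub_eq_zero.mp hs.symm).symm

/-- **Proposition 2.24** (vertex colouring): `s ↦ (Σ s_d) mod 3` is a proper vertex colouring
of `H_3^n` with the three colours `T = ZMod 3`.
[cite: HinzKlavzarPetr2018, Ch. 2 §2.3 Prop. 2.24, p. 120] -/
def titColoring (n : ℕ) : (hanoiGraph n).Coloring (ZMod 3) :=
  SimpleGraph.Coloring.mk titSum fun h => titSum_ne_of_adj h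

/-- **Proposition 2.24**: `χ(H_3^n) ≤ 3`.
[cite: HinzKlavzarPetr2018, Ch. 2 §2.3 Prop. 2.24, p. 120] -/
theorem colorable_three (n : ℕ) : (hanoiGraph n).Colorable 3 := by
  simpa [ZMod.card] using (titColoring n).colorable

/-- **Proposition 2.24**: `χ(H_3^n) ≥ 3` for `n ≥ 1` — the states `s̲0, s̲1, s̲2` «induce a
complete graph on 3 vertices». [cite: HinzKlavzarPetr2018, Ch. 2 §2.3 Prop. 2.24, p. 120] -/
theorem three_le_chromaticNumber {n : ℕ} (hn : 1 ≤ n) :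
    (3 : ℕ∞) ≤ (hanoiGraph n).chromaticNumber := by
  have h := SimpleGraph.le_chromaticNumber_of_pairwise_adj (G := hanoiGraph n) (n := 3)
    (ι := ZMod 3) (by rw [Nat.card_eq_fintype_card, ZMod.card])
    (fun a => Function.update (perfectWord n 0) ⟨0, hn⟩ a)
    (fun a b hab => adj_update_zero_update_zero hn _ hab)
  exact_mod_cast h

/-- **Proposition 2.24**: `χ(H_3^n) = 3` for every `n ∈ ℕ` (`n ≥ 1`).
[cite: HinzKlavzarPetr2018, Ch. 2 §2.3 Prop. 2.24, p. 120] -/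
theorem chromaticNumber_eq {n : ℕ} (hn : 1 ≤ n) : (hanoiGraph n).chromaticNumber = 3 := by
  apply le_antisymm
  · exact_mod_cast (colorable_three n).chromaticNumber_le
  · exact three_le_chromaticNumber hn

/-- `χ(H_3^0) = 1` (one vertex, no edge; the book takes `n ∈ ℕ = {1, 2, …}`).
[cite: HinzKlavzarPetr2018, Ch. 2 §2.3 Prop. 2.24, p. 120] -/
theorem chromaticNumber_zero : (hanoiGraph 0).chromaticNumber = 1 := by
  rw [hanoiGraph_zero_eq_bot]
  exact SimpleGraph.chromaticNumber_bot

/-- The label of the idle peg of the move between two adjacent states, written without choosing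
the moved disc: minus the sum of the two pegs of the (unique) disc whose position differs
(`3 - i - j` for a move between pegs `i` and `j`).
[cite: HinzKlavzarPetr2018, Ch. 2 §2.3 Prop. 2.24, p. 120] -/
def edgeIdle {n : ℕ} (f g : Fin n → ZMod 3) : ZMod 3 := -∑ e, if f e = g e then 0 else f e + g e

/-- The idle peg does not depend on the direction of the move.
[cite: HinzKlavzarPetr2018, Ch. 2 §2.3 Prop. 2.24, p. 120] -/
theorem edgeIdle_comm {n : ℕ} (f g : Fin n → ZMod 3) : edgeIdle f g = edgeIdle g f := by
  unfold edgeIdle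
  congr 1
  refine Finset.sum_congr rfl fun e _ => ?_
  by_cases h : f e = g e
  · rw [if_pos h, if_pos h.symm]
  · rw [if_neg h, if_neg (fun H => h H.symm), add_comm]

/-- For a move of disc `d` between pegs `i` and `j` the idle peg is `3 - i - j`.
[cite: HinzKlavzarPetr2018, Ch. 2 §2.3 Prop. 2.24, p. 120] -/
theorem edgeIdle_eq_thirdPeg {n : ℕ} {f g : Fin n → ZMod 3} {d : Fin n} (hne : f d ≠ g d)
    (hoff : ∀ e, e ≠ d → g e = f e) : edgeIdle f g = thirdPeg (f d) (g d) := by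
  unfold edgeIdle thirdPeg
  rw [Finset.sum_eq_single d (fun e _ he => by rw [if_pos (hoff e he).symm]) (by simp),
    if_neg hne]
  ring

/-- The idle peg of a move of disc 1 from peg `s_1` to peg `a` is `3 - s_1 - a`.
[cite: HinzKlavzarPetr2018, Ch. 2 §2.3 Prop. 2.24, p. 120] -/
theorem edgeIdle_update_zero {n : ℕ} (hn : 1 ≤ n) (f : Fin n → ZMod 3) {a : ZMod 3}
    (ha : a ≠ f ⟨0, hn⟩) :
    edgeIdle f (Function.update f ⟨0, hn⟩ a) = thirdPeg (f ⟨0, hn⟩) a := by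
  rw [edgeIdle_eq_thirdPeg (d := ⟨0, hn⟩) (by rw [Function.update_self]; exact ha.symm)
    (fun e he => Function.update_of_ne he _ _), Function.update_self]

/-- The idle peg of a move of another disc is «the position of disc 1».
[cite: HinzKlavzarPetr2018, Ch. 2 §2.3 Prop. 2.24, p. 120] -/
theorem edgeIdle_of_fix_zero {n : ℕ} (hn : 1 ≤ n) {f g : Fin n → ZMod 3}
    (h : (hanoiGraph n).Adj f g) (hz : g ⟨0, hn⟩ = f ⟨0, hn⟩) : edgeIdle f g = f ⟨0, hn⟩ := by
  obtain ⟨d, -, -, hne, rfl⟩ := adj_of_fix_zero hn h hz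
  have h3 := thirdPeg_spec (f ⟨0, hn⟩) (f d) hne.symm
  rw [edgeIdle_eq_thirdPeg (d := d) (by rw [Function.update_self]; exact h3.2.1.symm)
    (fun e he => Function.update_of_ne he _ _), Function.update_self,
    thirdPeg_comm (f ⟨0, hn⟩) (f d), (thirdPeg_thirdPeg hne).1]

/-- **Proposition 2.24** (edge colouring, the proof): «all edges coming together in a fixed
state correspond to moves with different idle pegs».
[cite: HinzKlavzarPetr2018, Ch. 2 §2.3 Prop. 2.24, p. 120] -/
theorem edgeIdle_ne_of_adj_of_adj {n : ℕ} {f g g' : Fin n → ZMod 3} (h : (hanoiGraph n).Adj f g)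
    (h' : (hanoiGraph n).Adj f g') (hgg : g ≠ g') : edgeIdle f g ≠ edgeIdle f g' := by
  have hn : 1 ≤ n := by
    obtain ⟨d₀, -⟩ := h
    exact d₀.pos
  by_cases hz : g ⟨0, hn⟩ = f ⟨0, hn⟩ <;> by_cases hz' : g' ⟨0, hn⟩ = f ⟨0, hn⟩
  · exact absurd (fix_zero_move_unique hn h h' hz hz') hgg
  · rw [edgeIdle_of_fix_zero hn h hz, eq_update_zero_of_adj hn h' hz',
      edgeIdle_update_zero hn f hz']
    exact (thirdPeg_spec _ _ (Ne.symm hz')).1.symm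
  · rw [edgeIdle_of_fix_zero hn h' hz', eq_update_zero_of_adj hn h hz,
      edgeIdle_update_zero hn f hz]
    exact (thirdPeg_spec _ _ (Ne.symm hz)).1
  · rw [eq_update_zero_of_adj hn h hz, eq_update_zero_of_adj hn h' hz',
      edgeIdle_update_zero hn f hz, edgeIdle_update_zero hn f hz']
    intro H
    apply hgg
    rw [eq_update_zero_of_adj hn h hz, eq_update_zero_of_adj hn h' hz']
    congr 1
    rw [← (thirdPeg_thirdPeg (Ne.symm hz)).1, ← (thirdPeg_thirdPeg (Ne.symm hz')).1, H]

/-- The idle-peg label as a function on unordered pairs of states (an edge labelling).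
[cite: HinzKlavzarPetr2018, Ch. 2 §2.3 Prop. 2.24, p. 120] -/
def idleLabel (n : ℕ) : Sym2 (Fin n → ZMod 3) → ZMod 3 :=
  Sym2.lift ⟨edgeIdle, edgeIdle_comm⟩

/-- The label of the edge `{f, g}` is the idle peg of the move `f → g`.
[cite: HinzKlavzarPetr2018, Ch. 2 §2.3 Prop. 2.24, p. 120] -/
theorem idleLabel_mk {n : ℕ} (f g : Fin n → ZMod 3) : idleLabel n s(f, g) = edgeIdle f g := rfl

/-- **Proposition 2.24** (edge colouring): «the label of the idle peg of the move associated
with an edge defines an edge coloring» — a proper vertex colouring of the line graph of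
`H_3^n` with the three colours `T`. [cite: HinzKlavzarPetr2018, Ch. 2 §2.3 Prop. 2.24, p. 120] -/
def idleColoring (n : ℕ) : (hanoiGraph n).lineGraph.Coloring (ZMod 3) :=
  SimpleGraph.Coloring.mk (fun e => idleLabel n e.val) fun {e₁ e₂} h => by
    obtain ⟨hne, v, hv₁, hv₂⟩ := SimpleGraph.lineGraph_adj_iff_exists.mp h
    have h₁ := Sym2.other_spec hv₁
    have h₂ := Sym2.other_spec hv₂
    have a₁ : (hanoiGraph n).Adj v (Sym2.Mem.other hv₁) := by
      rw [← SimpleGraph.mem_edgeSet, h₁]; exact e₁.prop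
    have a₂ : (hanoiGraph n).Adj v (Sym2.Mem.other hv₂) := by
      rw [← SimpleGraph.mem_edgeSet, h₂]; exact e₂.prop
    have hw : Sym2.Mem.other hv₁ ≠ Sym2.Mem.other hv₂ := fun H =>
      hne (Subtype.ext (by
        calc e₁.val = s(v, Sym2.Mem.other hv₁) := h₁.symm
          _ = s(v, Sym2.Mem.other hv₂) := by rw [H]
          _ = e₂.val := h₂))
    change idleLabel n e₁.val ≠ idleLabel n e₂.val
    rw [← h₁, ← h₂, idleLabel_mk, idleLabel_mk]
    exact edgeIdle_ne_of_adj_of_adj a₁ a₂ hw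

/-- **Proposition 2.24**: `χ'(H_3^n) ≤ 3` (the chromatic index as the chromatic number of the
line graph). [cite: HinzKlavzarPetr2018, Ch. 2 §2.3 Prop. 2.24, p. 120] -/
theorem lineGraph_colorable_three (n : ℕ) : (hanoiGraph n).lineGraph.Colorable 3 := by
  simpa [ZMod.card] using (idleColoring n).colorable

/-- In `ZMod 3`, a second element is the first plus `1` or plus `2`.
[cite: HinzKlavzarPetr2018, Ch. 2 §2.3 Prop. 2.24, p. 120] -/
theorem zmod3_eq_add_of_ne : ∀ c c' : ZMod 3, c ≠ c' → c' = c + 1 ∨ c' = c + 2 := by decide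

/-- **Proposition 2.24**: `χ'(H_3^n) ≥ 3` for `n ≥ 1` — the three edges of the triangle
`s̲0, s̲1, s̲2` pairwise meet. [cite: HinzKlavzarPetr2018, Ch. 2 §2.3 Prop. 2.24, p. 120] -/
theorem three_le_lineGraph_chromaticNumber {n : ℕ} (hn : 1 ≤ n) :
    (3 : ℕ∞) ≤ (hanoiGraph n).lineGraph.chromaticNumber := by
  let u : ZMod 3 → (Fin n → ZMod 3) := fun a => Function.update (perfectWord n 0) ⟨0, hn⟩ a
  have hu : Function.Injective u := fun a b h => by simpa [u] using congr_fun h ⟨0, hn⟩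
  have hadj : ∀ c : ZMod 3, (hanoiGraph n).Adj (u (c + 1)) (u (c + 2)) := fun c =>
    adj_update_zero_update_zero hn _ (by intro H; have := add_left_cancel H; revert this; decide)
  let F : ZMod 3 → (hanoiGraph n).edgeSet := fun c => ⟨s(u (c + 1), u (c + 2)), hadj c⟩
  have hmem : ∀ c c' : ZMod 3, c ≠ c' → u c ∈ (F c').val := fun c c' hcc' => by
    rcases zmod3_eq_add_of_ne c' c (Ne.symm hcc') with h | h
    · exact Sym2.mem_iff.mpr (Or.inl (by rw [h]))
    · exact Sym2.mem_iff.mpr (Or.inr (by rw [h]))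
  have h12 : ∀ c : ZMod 3, c ≠ c + 1 ∧ c ≠ c + 2 := by decide
  have hnot : ∀ c : ZMod 3, u c ∉ (F c).val := fun c H => by
    rcases Sym2.mem_iff.mp H with h | h
    · exact (h12 c).1 (hu h)
    · exact (h12 c).2 (hu h)
  have h := SimpleGraph.le_chromaticNumber_of_pairwise_adj (G := (hanoiGraph n).lineGraph)
    (n := 3) (ι := ZMod 3) (by rw [Nat.card_eq_fintype_card, ZMod.card]) F
    (fun c c' hcc' => by
      change (hanoiGraph n).lineGraph.Adj (F c) (F c')
      rw [SimpleGraph.lineGraph_adj_iff_exists]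
      refine ⟨fun H => hnot c (H ▸ hmem c c' hcc'), ?_⟩
      have e2 : ∀ c : ZMod 3, c + 1 + 1 = c + 2 := by decide
      have e4 : ∀ c : ZMod 3, c + 2 + 2 = c + 1 := by decide
      rcases zmod3_eq_add_of_ne c c' hcc' with h | h
      · refine ⟨u (c + 2), Sym2.mem_iff.mpr (Or.inr rfl), ?_⟩
        rw [h]
        change u (c + 2) ∈ s(u (c + 1 + 1), u (c + 1 + 2))
        rw [e2]
        exact Sym2.mem_iff.mpr (Or.inl rfl)
      · refine ⟨u (c + 1), Sym2.mem_iff.mpr (Or.inl rfl), ?_⟩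
        rw [h]
        change u (c + 1) ∈ s(u (c + 2 + 1), u (c + 2 + 2))
        rw [e4]
        exact Sym2.mem_iff.mpr (Or.inr rfl))
  exact_mod_cast h

/-- **Proposition 2.24**: `χ'(H_3^n) = 3` (`n ≥ 1`), the chromatic index typed as the chromatic
number of the line graph. [cite: HinzKlavzarPetr2018, Ch. 2 §2.3 Prop. 2.24, p. 120] -/
theorem lineGraph_chromaticNumber_eq {n : ℕ} (hn : 1 ≤ n) :
    (hanoiGraph n).lineGraph.chromaticNumber = 3 := by
  apply le_antisymm
  · exact_mod_cast (lineGraph_colorable_three n).chromaticNumber_le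
  · exact three_le_lineGraph_chromaticNumber hn

/-! ## Exercise 2.17: a total colouring with four colours -/

/-- The vertex part of the total colouring of Exercise 2.17 (Chapter 9): the colours `0, 1, 2` of
Proposition 2.24, inside the four colours `Option (ZMod 3)` (`none` being the fourth colour).
[cite: HinzKlavzarPetr2018, Exercise 2.17 and Ch. 9] -/
def totalVertexColour {n : ℕ} (f : Fin n → ZMod 3) : Option (ZMod 3) := some (titSum f)

/-- The edge part of the total colouring of Exercise 2.17 (Chapter 9): an edge of one of the
triangles `s̲0, s̲1, s̲2` (a move of disc 1) gets the colour of `{0, 1, 2}` missing at its two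
end vertices; «the remaining edges, representing moves of discs 2 to n», get the fourth colour.
[cite: HinzKlavzarPetr2018, Exercise 2.17 and Ch. 9] -/
def totalEdgeColour {n : ℕ} (hn : 1 ≤ n) (f g : Fin n → ZMod 3) : Option (ZMod 3) :=
  if f ⟨0, hn⟩ = g ⟨0, hn⟩ then none else some (-(titSum f + titSum g))

/-- The edge colour does not depend on the orientation of the edge.
[cite: HinzKlavzarPetr2018, Exercise 2.17 and Ch. 9] -/
theorem totalEdgeColour_comm {n : ℕ} (hn : 1 ≤ n) (f g : Fin n → ZMod 3) :
    totalEdgeColour hn f g = totalEdgeColour hn g f := by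
  unfold totalEdgeColour
  by_cases h : f ⟨0, hn⟩ = g ⟨0, hn⟩
  · rw [if_pos h, if_pos h.symm]
  · rw [if_neg h, if_neg (fun H => h H.symm), add_comm]

/-- The four colours. [cite: HinzKlavzarPetr2018, Exercise 2.17 and Ch. 9] -/
theorem card_totalColours : Fintype.card (Option (ZMod 3)) = 4 := by
  rw [Fintype.card_option, ZMod.card]

/-- **Exercise 2.17**, vertex–vertex: adjacent vertices get different colours.
[cite: HinzKlavzarPetr2018, Exercise 2.17 and Ch. 9] -/
theorem totalVertexColour_ne_of_adj {n : ℕ} {f g : Fin n → ZMod 3} (h : (hanoiGraph n).Adj f g) :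
    totalVertexColour f ≠ totalVertexColour g := by
  unfold totalVertexColour
  exact fun H => titSum_ne_of_adj h (Option.some_injective _ H)

/-- In `ZMod 3`: if `-(a + b) = a` then `b = a`.
[cite: HinzKlavzarPetr2018, Exercise 2.17 and Ch. 9] -/
theorem zmod3_neg_add_eq : ∀ a b : ZMod 3, -(a + b) = a → b = a := by decide

/-- **Exercise 2.17**, vertex–edge: a vertex and an incident edge get different colours
(«respecting the vertex colors already assigned»).
[cite: HinzKlavzarPetr2018, Exercise 2.17 and Ch. 9] -/
theorem totalVertexColour_ne_totalEdgeColour {n : ℕ} (hn : 1 ≤ n) {f g : Fin n → ZMod 3}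
    (h : (hanoiGraph n).Adj f g) : totalVertexColour f ≠ totalEdgeColour hn f g := by
  unfold totalVertexColour totalEdgeColour
  split_ifs with hz
  · exact Option.some_ne_none _
  · intro H
    exact titSum_ne_of_adj h (zmod3_neg_add_eq _ _ (Option.some_injective _ H).symm).symm

/-- **Exercise 2.17**, edge–edge: two edges at a common vertex get different colours.
[cite: HinzKlavzarPetr2018, Exercise 2.17 and Ch. 9] -/
theorem totalEdgeColour_ne_of_adj_of_adj {n : ℕ} (hn : 1 ≤ n) {f g g' : Fin n → ZMod 3}
    (h : (hanoiGraph n).Adj f g) (h' : (hanoiGraph n).Adj f g') (hgg : g ≠ g') :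
    totalEdgeColour hn f g ≠ totalEdgeColour hn f g' := by
  unfold totalEdgeColour
  by_cases hz : f ⟨0, hn⟩ = g ⟨0, hn⟩ <;> by_cases hz' : f ⟨0, hn⟩ = g' ⟨0, hn⟩
  · exact absurd (fix_zero_move_unique hn h h' hz.symm hz'.symm) hgg
  · rw [if_pos hz, if_neg hz']
    exact fun H => Option.some_ne_none _ H.symm
  · rw [if_neg hz, if_pos hz']
    exact Option.some_ne_none _
  · rw [if_neg hz, if_neg hz']
    intro H
    have H' : titSum g = titSum g' := by
      have := Option.some_injective _ H
      rwa [neg_inj, add_right_inj] at this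
    have hgu := eq_update_zero_of_adj hn h (Ne.symm hz)
    have hgu' := eq_update_zero_of_adj hn h' (Ne.symm hz')
    have hne : g ⟨0, hn⟩ ≠ g' ⟨0, hn⟩ := fun E => hgg (by rw [hgu, hgu', E])
    have hadj := adj_update_zero_update_zero hn f hne
    rw [← hgu, ← hgu'] at hadj
    exact titSum_ne_of_adj hadj H'


/-! ## Exercise 2.18: the size of `H_3^n`; Exercise 2.19 c) -/

/-- The three perfect words are distinct (`n ≥ 1`).
[cite: HinzKlavzarPetr2018, Ch. 2 §2.3 p. 120 (the perfect states); Exercise 2.18, Ch. 9] -/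
theorem perfectWord_injective {n : ℕ} (hn : 1 ≤ n) : Function.Injective (perfectWord n) :=
  fun i j h => by simpa [perfectWord] using congr_fun h ⟨0, hn⟩

/-- There are exactly three perfect states in `T^n`, `n ≥ 1`.
[cite: HinzKlavzarPetr2018, Ch. 2 §2.3 p. 120 (the perfect states); Exercise 2.18, Ch. 9] -/
theorem card_filter_perfectWords {n : ℕ} (hn : 1 ≤ n) [DecidablePred (· ∈ perfectWords n)] :
    (Finset.univ.filter (fun f : Fin n → ZMod 3 => f ∈ perfectWords n)).card = 3 := by
  have : Finset.univ.filter (fun f : Fin n → ZMod 3 => f ∈ perfectWords n) =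
      Finset.univ.image (perfectWord n) := by
    ext f
    simp only [Finset.mem_filter, Finset.mem_univ, true_and, Finset.mem_image, perfectWords,
      Set.mem_range]
  rw [this, Finset.card_image_of_injective _ (perfectWord_injective hn), Finset.card_univ,
    ZMod.card]

/-- The Handshaking Lemma's left-hand side: `Σ_s deg(s) = 3 · 3^n - 3` (`n ≥ 1`).
[cite: HinzKlavzarPetr2018, Exercise 2.18 and Ch. 9] -/
theorem sum_degrees {n : ℕ} (hn : 1 ≤ n) :
    ∑ f, (hanoiGraph n).degree f = 3 ^ (n + 1) - 3 := by
  classical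
  have h1 : ∀ f : Fin n → ZMod 3,
      (hanoiGraph n).degree f + (if f ∈ perfectWords n then 1 else 0) = 3 := fun f => by
    split_ifs with hf
    · rw [degree_of_mem_perfectWords hn hf]
    · rw [degree_of_not_mem_perfectWords hf]
  have h2 : ∑ f : Fin n → ZMod 3,
      ((hanoiGraph n).degree f + (if f ∈ perfectWords n then 1 else 0)) = 3 ^ n * 3 := by
    rw [Finset.sum_congr rfl (fun f _ => h1 f), Finset.sum_const, Finset.card_univ, smul_eq_mul,
      Fintype.card_fun, ZMod.card, Fintype.card_fin]
  rw [Finset.sum_add_distrib, Finset.sum_boole, card_filter_perfectWords hn] at h2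
  rw [pow_succ]
  omega

/-- **Exercise 2.18** with the Handshaking Lemma: `2‖H_3^n‖ = 3^{n+1} - 3`.
[cite: HinzKlavzarPetr2018, Exercise 2.18 and Ch. 9] -/
theorem two_mul_card_edgeFinset (n : ℕ) :
    2 * (hanoiGraph n).edgeFinset.card = 3 ^ (n + 1) - 3 := by
  have h := (hanoiGraph n).sum_degrees_eq_twice_card_edges
  rcases Nat.eq_zero_or_pos n with h0 | hn
  · subst h0
    rw [Finset.sum_eq_zero (fun f _ => degree_hanoiGraph_zero f)] at h
    omega
  · rw [sum_degrees hn] at h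
    omega

/-- **Exercise 2.18**: `‖H_3^n‖ = (3/2)(3^n - 1)`.
[cite: HinzKlavzarPetr2018, Exercise 2.18 and Ch. 9] -/
theorem exercise_2_18 (n : ℕ) : (hanoiGraph n).edgeFinset.card = 3 * (3 ^ n - 1) / 2 := by
  have h := two_mul_card_edgeFinset n
  have h1 : 1 ≤ 3 ^ n := Nat.one_le_pow _ _ (by norm_num)
  rw [pow_succ] at h
  omega

/-- **Exercise 2.18** (Chapter 9, the recurrence «stemming from (2.12)»):
`‖H_3^0‖ = 0`, `‖H_3^{1+n}‖ = 3(‖H_3^n‖ + 1)`.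
[cite: HinzKlavzarPetr2018, Exercise 2.18 and Ch. 9 (the recurrence from (2.12))] -/
theorem card_edgeFinset_recurrence (n : ℕ) : (hanoiGraph 0).edgeFinset.card = 0 ∧
    (hanoiGraph (n + 1)).edgeFinset.card = 3 * ((hanoiGraph n).edgeFinset.card + 1) := by
  have h0 := two_mul_card_edgeFinset 0
  have h1 := two_mul_card_edgeFinset n
  have h2 := two_mul_card_edgeFinset (n + 1)
  have hodd : 3 ^ n % 2 = 1 := Nat.odd_iff.mp (Odd.pow (by decide))
  have h3 : 1 ≤ 3 ^ n := Nat.one_le_pow _ _ (by norm_num)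
  rw [pow_succ] at h1
  rw [pow_succ, pow_succ] at h2
  constructor <;> omega

/-- **Exercise 2.19 c)**: «there are 3^n-3>2 vertices of odd degree 3» (`n ≥ 1`).
[cite: HinzKlavzarPetr2018, Exercise 2.19 c) and Ch. 9] -/
theorem card_filter_odd_degree {n : ℕ} (hn : 1 ≤ n) :
    (Finset.univ.filter (fun f : Fin n → ZMod 3 => Odd ((hanoiGraph n).degree f))).card =
      3 ^ n - 3 := by
  classical
  have he : Finset.univ.filter (fun f : Fin n → ZMod 3 => Odd ((hanoiGraph n).degree f)) =
      Finset.univ.filter (fun f => ¬ f ∈ perfectWords n) := by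
    ext f
    simp only [Finset.mem_filter, Finset.mem_univ, true_and]
    rcases exercise_2_16 hn f with ⟨h, hf⟩ | ⟨h, hf⟩
    · rw [h]
      exact ⟨fun H => absurd H (by decide), fun H => absurd hf H⟩
    · rw [h]
      exact ⟨fun _ => hf, fun _ => by decide⟩
  have hc := Finset.card_filter_add_card_filter_not (s := (Finset.univ : Finset (Fin n → ZMod 3)))
    (fun f => f ∈ perfectWords n)
  rw [card_filter_perfectWords hn, Finset.card_univ, Fintype.card_fun, ZMod.card,
    Fintype.card_fin] at hc
  rw [he]
  omega

/-- **Exercise 2.19 c)**: for `n ≥ 2` the graphs `H_3^n` «are not even semi-eulerian»: no walk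
is an Euler trail (closed or not), since more than two vertices have odd degree.
[cite: HinzKlavzarPetr2018, Exercise 2.19 c) and Ch. 9] -/
theorem not_isEulerian {n : ℕ} (hn : 2 ≤ n) {u v : Fin n → ZMod 3}
    (p : (hanoiGraph n).Walk u v) : ¬ p.IsEulerian := by
  intro hp
  have h := hp.card_filter_odd_degree
    (s := Finset.univ.filter (fun f : Fin n → ZMod 3 => Odd ((hanoiGraph n).degree f))) rfl
  rw [card_filter_odd_degree (by omega)] at h
  have h9 : 3 ^ 2 ≤ 3 ^ n := Nat.pow_le_pow_right (by norm_num) hn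
  omega

/-! ## Proposition 2.25: the connectivity of `H_3^n` is 2 -/

/-- The neighbourhood of a perfect state: the two moves of disc 1.
[cite: HinzKlavzarPetr2018, Ch. 2 §2.3 Prop. 2.25, p. 123] -/
theorem neighborFinset_of_mem_perfectWords {n : ℕ} (hn : 1 ≤ n) {f : Fin n → ZMod 3}
    (hf : f ∈ perfectWords n) : (hanoiGraph n).neighborFinset f =
      (Finset.univ.erase (f ⟨0, hn⟩)).image (fun a => Function.update f ⟨0, hn⟩ a) := by
  rw [← neighborFinset_filter_ne hn f]
  exact (Finset.filter_true_of_mem fun g hg =>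
    ne_of_adj_of_mem_perfectWords hn hf ((SimpleGraph.mem_neighborFinset _ _ _).mp hg)).symm

/-- Two different perfect states are not adjacent when `n ≥ 2`.
[cite: HinzKlavzarPetr2018, Ch. 2 §2.3 Prop. 2.25, p. 123] -/
theorem not_adj_perfectWord_perfectWord {n : ℕ} (hn : 2 ≤ n) (i j : ZMod 3) :
    ¬ (hanoiGraph n).Adj (perfectWord n i) (perfectWord n j) := by
  intro h
  have hn1 : 1 ≤ n := by omega
  have hij : perfectWord n j ⟨0, hn1⟩ ≠ perfectWord n i ⟨0, hn1⟩ :=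
    ne_of_adj_of_mem_perfectWords hn1 ⟨i, rfl⟩ h
  have hu := eq_update_zero_of_adj hn1 h hij
  have := congr_fun hu ⟨1, hn⟩
  rw [Function.update_of_ne (by simp [Fin.ext_iff])] at this
  exact hij this

/-- **Proposition 2.25**, `κ(H_3^n) ≤ 2`: «Deleting the two neighbors of a perfect state will
separate the latter from the rest of the graph» — the subgraph induced on the non-neighbours of
`i^n` is disconnected (`n ≥ 2`; the deleted vertices are `2` in number by
`degree_perfectWord`). [cite: HinzKlavzarPetr2018, Ch. 2 §2.3 Prop. 2.25, p. 123] -/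
theorem proposition_2_25_cut {n : ℕ} (hn : 2 ≤ n) (i : ZMod 3) :
    ¬ ((hanoiGraph n).induce {g | ¬ (hanoiGraph n).Adj (perfectWord n i) g}).Connected := by
  intro hc
  obtain ⟨j, hj⟩ : ∃ j : ZMod 3, j ≠ i := ⟨i + 1, by
    intro H; have := add_left_cancel (H.trans (add_zero i).symm); revert this; decide⟩
  have hii : perfectWord n i ∈ {g | ¬ (hanoiGraph n).Adj (perfectWord n i) g} :=
    fun H => (hanoiGraph n).loopless.irrefl _ H
  have hjj : perfectWord n j ∈ {g | ¬ (hanoiGraph n).Adj (perfectWord n i) g} :=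
    not_adj_perfectWord_perfectWord hn i j
  have hr := (SimpleGraph.reachable_iff_reflTransGen _ _).mp
    (hc.preconnected ⟨perfectWord n i, hii⟩ ⟨perfectWord n j, hjj⟩)
  rcases Relation.ReflTransGen.cases_head hr with h | ⟨x, hx, -⟩
  · exact hj.symm (perfectWord_injective (by omega) (Subtype.ext_iff.mp h))
  · rw [SimpleGraph.comap_adj] at hx
    exact x.prop hx

/-- Walks avoiding a vertex `v`: the reflexive–transitive closure of the legal moves between
states different from `v`. [cite: HinzKlavzarPetr2018, Ch. 2 §2.3 Prop. 2.25, p. 123] -/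
def HanoiAvoidReach (n : ℕ) (v f g : Fin n → ZMod 3) : Prop :=
  Relation.ReflTransGen (fun a b => (hanoiGraph n).Adj a b ∧ a ≠ v ∧ b ≠ v) f g

/-- Inside a subgraph `iH_3^n` not containing `v`, every two states are joined avoiding `v`.
[cite: HinzKlavzarPetr2018, Ch. 2 §2.3 Prop. 2.25, p. 123] -/
theorem hanoiAvoidReach_snoc_of_ne {n : ℕ} {v : Fin (n + 1) → ZMod 3} {i : ZMod 3}
    (hi : v (Fin.last n) ≠ i) (r s : Fin n → ZMod 3) :
    HanoiAvoidReach (n + 1) v (Fin.snoc r i) (Fin.snoc s i) := by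
  have h := (SimpleGraph.reachable_iff_reflTransGen r s).mp
    ((hanoiGraph_connected n).preconnected r s)
  have hle : ∀ a b : Fin n → ZMod 3, (hanoiGraph n).Adj a b →
      (hanoiGraph (n + 1)).Adj (Fin.snoc a i : Fin (n + 1) → ZMod 3) (Fin.snoc b i) ∧
        (Fin.snoc a i : Fin (n + 1) → ZMod 3) ≠ v ∧ (Fin.snoc b i : Fin (n + 1) → ZMod 3) ≠ v :=
    fun a b hab => ⟨adj_snoc_snoc_iff.mpr hab, fun H => hi (by rw [← H, Fin.snoc_last]),
      fun H => hi (by rw [← H, Fin.snoc_last])⟩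
  exact Relation.ReflTransGen.lift
    (fun r : Fin n → ZMod 3 => (Fin.snoc r i : Fin (n + 1) → ZMod 3)) hle r s h

/-- Inside the subgraph `iH_3^n` containing `v = v̲ i`: states avoiding `v̲` in `H_3^n` lift.
[cite: HinzKlavzarPetr2018, Ch. 2 §2.3 Prop. 2.25, p. 123] -/
theorem hanoiAvoidReach_snoc_of_avoidReach {n : ℕ} {w : Fin n → ZMod 3} {i : ZMod 3}
    {r s : Fin n → ZMod 3} (h : HanoiAvoidReach n w r s) :
    HanoiAvoidReach (n + 1) (Fin.snoc w i) (Fin.snoc r i) (Fin.snoc s i) := by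
  have hle : ∀ a b : Fin n → ZMod 3, ((hanoiGraph n).Adj a b ∧ a ≠ w ∧ b ≠ w) →
      (hanoiGraph (n + 1)).Adj (Fin.snoc a i : Fin (n + 1) → ZMod 3) (Fin.snoc b i) ∧
        (Fin.snoc a i : Fin (n + 1) → ZMod 3) ≠ Fin.snoc w i ∧
        (Fin.snoc b i : Fin (n + 1) → ZMod 3) ≠ Fin.snoc w i :=
    fun a b hab => ⟨adj_snoc_snoc_iff.mpr hab.1, fun H => hab.2.1 (Fin.snoc_inj.mp H).1,
      fun H => hab.2.2 (Fin.snoc_inj.mp H).1⟩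
  exact Relation.ReflTransGen.lift
    (fun r : Fin n → ZMod 3 => (Fin.snoc r i : Fin (n + 1) → ZMod 3)) hle r s h

/-- The bridge of (2.12): `ik^n` and `jk^n` are adjacent, `k = 3 - i - j`.
[cite: HinzKlavzarPetr2018, Ch. 2 §2.3 Prop. 2.25, p. 123] -/
theorem adj_bridge {n : ℕ} {i j : ZMod 3} (hij : i ≠ j) :
    (hanoiGraph (n + 1)).Adj (Fin.snoc (perfectWord n (thirdPeg i j)) i : Fin (n + 1) → ZMod 3)
      (Fin.snoc (perfectWord n (thirdPeg i j)) j) :=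
  (adj_snoc_snoc_iff_of_ne hij).mpr ⟨rfl, rfl⟩

/-- **Proposition 2.25**, the induction: for `n ≥ 1`, any two states different from `v` are
joined by a sequence of legal moves avoiding `v` («the deletion of only one vertex is not
sufficient»). [cite: HinzKlavzarPetr2018, Ch. 2 §2.3 Prop. 2.25, p. 123] -/
theorem hanoiAvoidReach_of_ne {n : ℕ} (hn : 1 ≤ n) (v f g : Fin n → ZMod 3) (hf : f ≠ v)
    (hg : g ≠ v) :
    HanoiAvoidReach n v f g := by
  induction n, hn using Nat.le_induction with
  | base =>
    by_cases hfg : f = g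
    · subst hfg
      exact Relation.ReflTransGen.refl
    · exact Relation.ReflTransGen.single ⟨hanoiGraph_one_adj_iff.mpr hfg, hf, hg⟩
  | succ n hn ih =>
    -- the largest disc of `v`, `f`, `g`
    have hv : v = Fin.snoc (Fin.init v) (v (Fin.last n)) := eq_snoc v
    -- within one block `iH_3^n`
    have block : ∀ (i : ZMod 3) (r s : Fin n → ZMod 3),
        (Fin.snoc r i : Fin (n + 1) → ZMod 3) ≠ v → (Fin.snoc s i : Fin (n + 1) → ZMod 3) ≠ v →
        HanoiAvoidReach (n + 1) v (Fin.snoc r i) (Fin.snoc s i) := by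
      intro i r s hr hs
      by_cases hi : v (Fin.last n) = i
      · have hr' : r ≠ Fin.init v := fun H => hr (by rw [hv, H, hi])
        have hs' : s ≠ Fin.init v := fun H => hs (by rw [hv, H, hi])
        have h := hanoiAvoidReach_snoc_of_avoidReach (i := i) (ih (Fin.init v) r s hr' hs')
        rw [hv, hi]
        exact h
      · exact hanoiAvoidReach_snoc_of_ne hi r s
    have hf' : (Fin.snoc (Fin.init f) (f (Fin.last n)) : Fin (n + 1) → ZMod 3) ≠ v := by
      rw [← eq_snoc f]; exact hf
    have hg' : (Fin.snoc (Fin.init g) (g (Fin.last n)) : Fin (n + 1) → ZMod 3) ≠ v := by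
      rw [← eq_snoc g]; exact hg
    rw [eq_snoc f, eq_snoc g]
    by_cases hij : f (Fin.last n) = g (Fin.last n)
    · rw [hij] at hf' ⊢
      exact block _ _ _ hf' hg'
    -- across blocks `i ≠ j`: the detour `f ~ j^n i — j^n k ~ i^n k — i^n j ~ g` through the
    -- third block `k`, unless it meets `v`; in that case the direct bridge `k^n i — k^n j` is free
    have hk := thirdPeg_spec (f (Fin.last n)) (g (Fin.last n)) hij
    have hkk := thirdPeg_thirdPeg hij
    have hpi := perfectWord_injective hn
    by_cases hv1 :
        (Fin.snoc (perfectWord n (g (Fin.last n))) (f (Fin.last n)) : Fin (n + 1) → ZMod 3) ≠ v ∧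
        (Fin.snoc (perfectWord n (g (Fin.last n))) (thirdPeg (f (Fin.last n)) (g (Fin.last n))) :
          Fin (n + 1) → ZMod 3) ≠ v ∧
        (Fin.snoc (perfectWord n (f (Fin.last n))) (thirdPeg (f (Fin.last n)) (g (Fin.last n))) :
          Fin (n + 1) → ZMod 3) ≠ v ∧
        (Fin.snoc (perfectWord n (f (Fin.last n))) (g (Fin.last n)) : Fin (n + 1) → ZMod 3) ≠ v
    · obtain ⟨h1, h2, h3, h4⟩ := hv1
      have b1 : (hanoiGraph (n + 1)).Adj
          (Fin.snoc (perfectWord n (g (Fin.last n))) (f (Fin.last n)) : Fin (n + 1) → ZMod 3)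
          (Fin.snoc (perfectWord n (g (Fin.last n)))
            (thirdPeg (f (Fin.last n)) (g (Fin.last n)))) := by
        have := adj_bridge (n := n) (i := f (Fin.last n))
          (j := thirdPeg (f (Fin.last n)) (g (Fin.last n))) hk.1.symm
        rwa [hkk.1] at this
      have b2 : (hanoiGraph (n + 1)).Adj
          (Fin.snoc (perfectWord n (f (Fin.last n))) (thirdPeg (f (Fin.last n)) (g (Fin.last n))) :
            Fin (n + 1) → ZMod 3)
          (Fin.snoc (perfectWord n (f (Fin.last n))) (g (Fin.last n))) := by
        have := adj_bridge (n := n) (i := thirdPeg (f (Fin.last n)) (g (Fin.last n)))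
          (j := g (Fin.last n)) hk.2.1
        rwa [hkk.2] at this
      exact (((block _ _ _ hf' h1).trans (Relation.ReflTransGen.single ⟨b1, h1, h2⟩)).trans
        (block _ _ _ h2 h3)).trans ((Relation.ReflTransGen.single ⟨b2, h3, h4⟩).trans
        (block _ _ _ h4 hg'))
    · have d1 : (Fin.snoc (perfectWord n (thirdPeg (f (Fin.last n)) (g (Fin.last n))))
          (f (Fin.last n)) : Fin (n + 1) → ZMod 3) ≠ v := by
        intro H
        apply hv1
        refine ⟨?_, ?_, ?_, ?_⟩ <;> intro E <;> have E' := Fin.snoc_inj.mp (E.trans H.symm)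
        · exact hk.2.1 (hpi E'.1).symm
        · exact hk.1 E'.2
        · exact hk.1 E'.2
        · exact hij E'.2.symm
      have d2 : (Fin.snoc (perfectWord n (thirdPeg (f (Fin.last n)) (g (Fin.last n))))
          (g (Fin.last n)) : Fin (n + 1) → ZMod 3) ≠ v := by
        intro H
        apply hv1
        refine ⟨?_, ?_, ?_, ?_⟩ <;> intro E <;> have E' := Fin.snoc_inj.mp (E.trans H.symm)
        · exact hij E'.2
        · exact hk.2.1 E'.2
        · exact hk.2.1 E'.2
        · exact hk.1 (hpi E'.1).symm
      exact ((block _ _ _ hf' d1).trans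
        (Relation.ReflTransGen.single ⟨adj_bridge hij, d1, d2⟩)).trans (block _ _ _ d2 hg')

/-- **Proposition 2.25**, `κ(H_3^n) ≥ 2`: deleting any single vertex of `H_3^n`, `n ≥ 1`,
leaves a connected graph. [cite: HinzKlavzarPetr2018, Ch. 2 §2.3 Prop. 2.25, p. 123] -/
theorem proposition_2_25_no_cut_vertex {n : ℕ} (hn : 1 ≤ n) (v : Fin n → ZMod 3) :
    ((hanoiGraph n).induce ({v}ᶜ : Set (Fin n → ZMod 3))).Connected := by
  rw [SimpleGraph.connected_iff]
  refine ⟨fun a b => ?_, ⟨⟨Function.update v ⟨0, hn⟩ (v ⟨0, hn⟩ + 1), fun H => ?_⟩⟩⟩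
  · obtain ⟨a, ha⟩ := a
    obtain ⟨b, hb⟩ := b
    have h := hanoiAvoidReach_of_ne hn v a b ha hb
    unfold HanoiAvoidReach at h
    revert hb
    induction h with
    | refl => exact fun _ => SimpleGraph.Reachable.refl _
    | tail _ hcd ih =>
      intro hd
      exact (ih hcd.2.1).trans (SimpleGraph.Adj.reachable (by
        rw [SimpleGraph.comap_adj]
        exact hcd.1))
  · have := congr_fun (Set.mem_singleton_iff.mp H) ⟨0, hn⟩
    rw [Function.update_self] at this
    have h3 : ∀ a : ZMod 3, a + 1 ≠ a := by decide
    exact h3 _ this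

/-- **Proposition 2.25**: `κ(H_3^n) = 2` (`n ≥ 2`), typed as: no single vertex disconnects
`H_3^n`, and some two vertices (the neighbours of `0^n`) do. (Mathlib has no vertex-connectivity
number; for `n = 1`, `H_3^1 ≅ K_3` has `κ = 2` by the convention `κ(K_m) = m - 1`.)
[cite: HinzKlavzarPetr2018, Ch. 2 §2.3 Prop. 2.25, p. 123] -/
theorem proposition_2_25 {n : ℕ} (hn : 2 ≤ n) :
    (∀ v, ((hanoiGraph n).induce ({v}ᶜ : Set (Fin n → ZMod 3))).Connected) ∧
      ∃ S : Finset (Fin n → ZMod 3), S.card = 2 ∧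
        ¬ ((hanoiGraph n).induce ((↑S : Set (Fin n → ZMod 3))ᶜ)).Connected := by
  refine ⟨fun v => proposition_2_25_no_cut_vertex (by omega) v,
    (hanoiGraph n).neighborFinset (perfectWord n 0), ?_, ?_⟩
  · rw [SimpleGraph.card_neighborFinset_eq_degree, degree_perfectWord (by omega)]
  · have hS : ((↑((hanoiGraph n).neighborFinset (perfectWord n 0)) : Set (Fin n → ZMod 3))ᶜ) =
        {g | ¬ (hanoiGraph n).Adj (perfectWord n 0) g} := by
      ext g
      simp
    rw [hS]
    exact proposition_2_25_cut hn 0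

end Literature.Combinatorics.Hinz2018
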